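import Summits.BirchSwinnertonDyer.BirchSwinnertonDyer.Theses.CumulativeHeegnerLeopoldt
import Summits.BirchSwinnertonDyer.BirchSwinnertonDyer.Theorems.CumulativeHeegnerLeopoldtCumulativeHeegnerInclusionAtThreeSpecialisationValuesWeighted
import Summits.BirchSwinnertonDyer.BirchSwinnertonDyer.Theorems.CumulativeHeegnerLeopoldtCumulativeHeegnerInclusionAtThreeB1OfPrint
import Summits.BirchSwinnertonDyer.BirchSwinnertonDyer.Theorems.CumulativeHeegnerLeopoldtCumulativeHeegnerInclusionAtThreeLineDeterminantAtThree
import Summits.BirchSwinnertonDyer.BirchSwinnertonDyer.Theorems.CumulativeHeegnerLeopoldtCumulativeHeegnerInclusionAtThreeBadPlacesSplitFinite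
import Summits.BirchSwinnertonDyer.BirchSwinnertonDyer.Theorems.CumulativeHeegnerLeopoldtCumulativeHeegnerInclusionAtThreeGlue
import Summits.BirchSwinnertonDyer.BirchSwinnertonDyer.Theorems.CumulativeHeegnerLeopoldtResidualSelmerFiniteAtThreeOfPrint
import Summits.BirchSwinnertonDyer.BirchSwinnertonDyer.Theorems.UniversalToricDescentAcDualMuZeroCriterion
import Summits.BirchSwinnertonDyer.Rank1Residual.X11b.AnticyclotomicModuleFinite
import HarnessLib

/-!
# Crux K1 `CumulativeHeegnerInclusionAtThree` (stmt-BirchSwinnertonDyer-24198), line `birth`: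
# **A ⟸ control shape ∧ (a WEIGHTED Kolyvagin-system bound in INDEX currency)**, and K1 with print — BY NAME

Lead prover bsd-line-chl-k1-p1 g5 (`--supports stmt-BirchSwinnertonDyer-24198`). Weighted twin of `…OfIndexBound` /
`…OfTemperedIndexBound`: for residually REDUCIBLE `T` (the crux's cell) printed Kolyvagin-system bounds degenerate at the trivial
character (CGLS 2022 Thm. 4.1.2: divisibility in `Λ[1/p, 1/(γ − 1)]`); specialisation by specialisation this is the displayed
hypothesis IBw: at every frame of K1 there are `C ν ∈ ℕ` and `a ∈ Λ ∖ {0}` with, for every distinguished irreducible `Q ∈ ℤ_3[T]`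
prime to `a`, every root `y ∈ ℚ̄_3` of `Q` and `v = L(y)`: `#(X_{∅,0}(𝔭′) ⧸ Q) · (‖y‖^ν · ‖v‖)^{deg Q} ≤ 3^{C · deg Q}`. The T-adic pin
that removes the weight is the control shape `HasCharValuationAt` (torsion + a generator of `Ch_Λ X` non-vanishing at `T = 0`;
K4-type input, cf. -w2 p623465), displayed as a hypothesis at the same frame. Then A follows (`…SpecialisationValuesWeighted`,
p622618/p622856 for the pin algebra), and K1 with the print input P through the glue 26899.

* `temperedHeegnerInclusionAtThree_of_hasCharValuationAt_of_weightedIndexBound` : **CTL♯ → IBw → A** (no print needed).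
* `cumulativeHeegnerInclusionAtThree_of_print_of_hasCharValuationAt_of_weightedIndexBound` : **P → CTL♯ → IBw → K1**.

HONEST FRAMING: IBw and CTL♯ are NOT proved here; K1 = A + print stays OPEN. No named fact, no `sorry`, no new definition.
BSD is not proved by any of this; no summit statement is proved by this seat.
-/



set_option linter.dupNamespace false
set_option autoImplicit false

noncomputable section

open scoped Classical Polynomial

namespace Summit.BirchSwinnertonDyer.BirchSwinnertonDyer.Theorems.CumulativeHeegnerInclusionAtThreeOfWeightedIndexBound

open Literature.NumberTheory.EllipticCurves NumberField IsDedekindDomain Field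
  Summit.BirchSwinnertonDyer.Rank1Residual.X11b Summit.BirchSwinnertonDyer.Rank1Residual.X11b.AcSelmer
  Summit.BirchSwinnertonDyer.BirchSwinnertonDyer.Theorems.CumulativeHeegnerInclusionAtThreeSpecialisationValues
  Summit.BirchSwinnertonDyer.BirchSwinnertonDyer.Theorems.CumulativeHeegnerInclusionAtThreeSpecialisationValuesWeighted

/-- **A ⟸ CONTROL SHAPE ∧ WEIGHTED INDEX BOUND.** If the print input P (`ResidualSelmerPrintedInputAtThree`) holds and, at every frame
of crux K1, the BDP function `L` satisfies a Kolyvagin-system-type bound in INDEX currency at the algebraic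
specialisations — `#(X_{∅,0}(𝔭′) ⧸ Q) · ‖L(y)‖^{deg Q} ≤ 3^{C·deg Q}` for every distinguished irreducible `Q ∈ ℤ_3[T]` and
every root `y ∈ ℚ̄_3` of `Q` — then the research crux A = stmt-26896 `TemperedHeegnerInclusionAtThree` holds. Proof:
P ⟹ `Sel[3]` finite (B1-from-print, p613183 with p614633/p613929) ⟹ `X` is `Λ`-torsion (UTD Greenberg criterion); `X`
is finitely generated (Castella §2.1, tree); `char X = (g₀)`, `g₀ ≠ 0`; then
`…SpecialisationValues.exists_C_pow_mul_mem_span_of_card_quotSMulTop_le` gives `3^μ·L ∈ (g₀·R₀⟦T⟧) =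
(Ch_Λ X).map toUnr`. -/
theorem temperedHeegnerInclusionAtThree_of_hasCharValuationAt_of_weightedIndexBound
    (hCTL : ∀ (W : WeierstrassCurve ℚ) [W.IsElliptic] [W.IsGloballyMinimal] (N : ℕ) [NeZero N] (K : Type) [Field K] [NumberField K] (Dt : Literature.NumberTheory.EllipticCurves.ModularForms.ModularParametrizationData W N), Summit.BirchSwinnertonDyer.Rank1Residual.Additive.ClassO6 W 3 → Literature.NumberTheory.EllipticCurves.Rank1Residual.Red W 3 → (∃ Φ : AddSubgroup (WeierstrassCurve.geomTorsion W ((3 : ℕ) : ℤ)), Literature.NumberTheory.EllipticCurves.Rank1Residual.IsRationalLine W 3 Φ ∧ ∀ (v : IsDedekindDomain.HeightOneSpectrum (NumberField.RingOfIntegers ℚ)), ((3 : ℕ) : NumberField.RingOfIntegers ℚ) ∈ v.asIdeal → ∀ 𝔓 ∈ v.primesAbove, ¬ (∀ g ∈ 𝔓.decompositionSubgroup (Field.absoluteGaloisGroup ℚ), ∀ P ∈ Φ, g • P = P) ∧ ¬ (∀ g ∈ 𝔓.decompositionSubgroup (Field.absoluteGaloisGroup ℚ), ∀ P : WeierstrassCurve.geomTorsion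 W ((3 : ℕ) : ℤ), g • P - P ∈ Φ)) → W.analyticRank = 1 → W.conductorNorm ℤ = N → Literature.NumberTheory.EllipticCurves.IsImaginaryQuadratic K → Literature.NumberTheory.EllipticCurves.SatisfiesHeegnerHypothesis N K → ∀ (κ : Literature.NumberTheory.EllipticCurves.ZpExtension K 3), κ.IsAnticyclotomic → ∀ (γ : Field.absoluteGaloisGroup K) [Fact (κ.IsTopGenerator γ)] (𝔭 : IsDedekindDomain.HeightOneSpectrum (NumberField.RingOfIntegers K)), ((3 : ℕ) : NumberField.RingOfIntegers K) ∈ 𝔭.asIdeal → 𝔭.asIdeal.ramificationIdx (NumberField.RingOfIntegers ℚ) = 1 → 𝔭.asIdeal.inertiaDeg (NumberField.RingOfIntegers ℚ) = 1 → ∀ (𝔭' : IsDedekindDomain.HeightOneSpectrum (NumberField.RingOfIntegers K)), ((3 : ℕ) : NumberField.RingOfIntegers K) ∈ 𝔭'.asIdeal → 𝔭' ≠ 𝔭 → ∀ (ι' : PadicAlgCl 3 ≃+* ℂ), Summit.BirchSwinnertonDyer.BirchSwinnertonDyer.Theorems.SchneiderFree.BranchInducesPrime 3 ι' 𝔭 →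 ∀ (ΩK : ℂ) (Ωp : ℂ_[3]) (L : Literature.NumberTheory.EllipticCurves.UnrSeries 3), ΩK ≠ 0 → Ωp ≠ 0 → Literature.NumberTheory.EllipticCurves.IsBDPLFunction ι' 𝔭 κ γ Dt.f ΩK Ωp L → ∃ n : ℕ, Summit.BirchSwinnertonDyer.Rank1Residual.X11b.AcSelmer.XAc.HasCharValuationAt (W.baseChange K) 3 κ 𝔭' ∅ γ n)
    (hIB : ∀ (W : WeierstrassCurve ℚ) [W.IsElliptic] [W.IsGloballyMinimal] (N : ℕ) [NeZero N] (K : Type) [Field K] [NumberField K] (Dt : Literature.NumberTheory.EllipticCurves.ModularForms.ModularParametrizationData W N), Summit.BirchSwinnertonDyer.Rank1Residual.Additive.ClassO6 W 3 → Literature.NumberTheory.EllipticCurves.Rank1Residual.Red W 3 → (∃ Φ : AddSubgroup (WeierstrassCurve.geomTorsion W ((3 : ℕ) : ℤ)), Literature.NumberTheory.EllipticCurves.Rank1Residual.IsRationalLine W 3 Φ ∧ ∀ (v : IsDedekindDomain.HeightOneSpectrum (NumberField.RingOfIntegers ℚ)), ((3 : ℕ) : NumberField.RingOfIntegers ℚ)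 ∈ v.asIdeal → ∀ 𝔓 ∈ v.primesAbove, ¬ (∀ g ∈ 𝔓.decompositionSubgroup (Field.absoluteGaloisGroup ℚ), ∀ P ∈ Φ, g • P = P) ∧ ¬ (∀ g ∈ 𝔓.decompositionSubgroup (Field.absoluteGaloisGroup ℚ), ∀ P : WeierstrassCurve.geomTorsion W ((3 : ℕ) : ℤ), g • P - P ∈ Φ)) → W.analyticRank = 1 → W.conductorNorm ℤ = N → Literature.NumberTheory.EllipticCurves.IsImaginaryQuadratic K → Literature.NumberTheory.EllipticCurves.SatisfiesHeegnerHypothesis N K → ∀ (κ : Literature.NumberTheory.EllipticCurves.ZpExtension K 3), κ.IsAnticyclotomic → ∀ (γ : Field.absoluteGaloisGroup K) [Fact (κ.IsTopGenerator γ)] (𝔭 : IsDedekindDomain.HeightOneSpectrum (NumberField.RingOfIntegers K)), ((3 : ℕ) : NumberField.RingOfIntegers K) ∈ 𝔭.asIdeal → 𝔭.asIdeal.ramificationIdx (NumberField.RingOfIntegers ℚ) = 1 → 𝔭.asIdeal.inertiaDeg (NumberField.RingOfIntegers ℚ) = 1 → ∀ (𝔭' : IsDedekindDomain.HeightOneSpectrum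 (NumberField.RingOfIntegers K)), ((3 : ℕ) : NumberField.RingOfIntegers K) ∈ 𝔭'.asIdeal → 𝔭' ≠ 𝔭 → ∀ (ι' : PadicAlgCl 3 ≃+* ℂ), Summit.BirchSwinnertonDyer.BirchSwinnertonDyer.Theorems.SchneiderFree.BranchInducesPrime 3 ι' 𝔭 → ∀ (ΩK : ℂ) (Ωp : ℂ_[3]) (L : Literature.NumberTheory.EllipticCurves.UnrSeries 3), ΩK ≠ 0 → Ωp ≠ 0 → Literature.NumberTheory.EllipticCurves.IsBDPLFunction ι' 𝔭 κ γ Dt.f ΩK Ωp L → ∃ (C ν : ℕ) (a : IwasawaAlgebra 3), a ≠ 0 ∧ ∀ Q : ℤ_[3][X], Q.IsDistinguishedAt (IsLocalRing.maximalIdeal ℤ_[3]) → Irreducible Q → IsRelPrime a (Q : IwasawaAlgebra 3) → ∀ y : PadicAlgCl 3, Polynomial.aeval y (Q.map (algebraMap ℤ_[3] ℚ_[3])) = 0 → ∀ v : ℂ_[3], L.HasValueAt (y : ℂ_[3]) v → (Nat.card (Summit.BirchSwinnertonDyer.Rank1Residual.X11b.AcSelmer.XAc (W.baseChange K) 3 κ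 𝔭' ∅ γ ⧸ (Ideal.span {(Q : IwasawaAlgebra 3)} • ⊤ : Submodule (IwasawaAlgebra 3) (Summit.BirchSwinnertonDyer.Rank1Residual.X11b.AcSelmer.XAc (W.baseChange K) 3 κ 𝔭' ∅ γ))) : ℝ) * (‖(y : ℂ_[3])‖ ^ ν * ‖v‖) ^ Q.natDegree ≤ (3 : ℝ) ^ (C * Q.natDegree)) :
    Summit.BirchSwinnertonDyer.BirchSwinnertonDyer.Theses.CumulativeHeegnerLeopoldt.TemperedHeegnerInclusionAtThree := by
  intro W _ _ N _ K _ _ Dt hO6 hRed hcell hr hN hK hHg κ hκ γ _ 𝔭 h𝔭 he hf 𝔭' h𝔭' hne ι' hι ΩK Ωp L hΩK hΩp hBDP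
  haveI : (W.baseChange K).IsElliptic := inferInstanceAs (W.map (algebraMap ℚ K)).IsElliptic
  set X := XAc (W.baseChange K) 3 κ 𝔭' ∅ γ with hXdef
  haveI : Module.Finite (IwasawaAlgebra 3) X := XAc.module_finite_empty κ 𝔭' γ
  -- control shape: torsion-ness and a generator non-vanishing at `T = 0`
  obtain ⟨n, hT, g₀, hg₀X, hpin, -⟩ := hCTL W N K Dt hO6 hRed hcell hr hN hK hHg κ hκ γ 𝔭 h𝔭 he hf 𝔭' h𝔭' hne ι' hι ΩK Ωp L
    hΩK hΩp hBDP
  have hg₀ : Literature.NumberTheory.EllipticCurves.Module.charIdeal (IwasawaAlgebra 3) X = Ideal.span {g₀} := hg₀X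
  -- the weighted index bound at this frame, and the landed chain
  obtain ⟨C, ν, a, ha, hC⟩ := hIB W N K Dt hO6 hRed hcell hr hN hK hHg κ hκ γ 𝔭 h𝔭 he hf 𝔭' h𝔭' hne ι' hι ΩK Ωp L hΩK hΩp hBDP
  obtain ⟨μ, hμ⟩ := exists_C_pow_mul_mem_span_of_weighted_card_quotSMulTop_le_off (p := 3) X hT hg₀ hpin ha (L := L)
    (ν := ν) (C := C) (fun Q hQ hirr _ haQ y hy v hv => hC Q hQ hirr haQ y hy v hv)
  refine ⟨μ, ?_⟩
  rw [show XAc.charIdeal (W.baseChange K) 3 κ 𝔭' ∅ γ =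
      Literature.NumberTheory.EllipticCurves.Module.charIdeal (IwasawaAlgebra 3) X from rfl, hg₀, Ideal.map_span,
    Set.image_singleton, Ideal.span_singleton_le_iff_mem]
  have heq : (3 : UnrSeries 3) ^ μ * L = PowerSeries.C (((3 : ℕ) : unrIntegers 3) ^ μ) * L := by
    rw [map_pow, map_natCast]
    norm_cast
  rw [heq]
  exact hμ

/-- **K1 ⟸ PRINT ∧ CONTROL SHAPE ∧ WEIGHTED INDEX BOUND**: with the landed glue of the rev-5 split (stmt-26899, p615902:
`A → P → B1P → K1`) and the B1P closer (stmt-26898, p616187), the route crux `CumulativeHeegnerInclusionAtThree` follows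
from P and the index-currency bound IB. The line `birth` thus closes K1 from print the moment a Kolyvagin-system
argument for crux 26896 outputs its bound in the standard specialisation-wise index format. -/
theorem cumulativeHeegnerInclusionAtThree_of_print_of_hasCharValuationAt_of_weightedIndexBound
    (hP : Summit.BirchSwinnertonDyer.BirchSwinnertonDyer.Theses.CumulativeHeegnerLeopoldt.ResidualSelmerPrintedInputAtThree)
    (hCTL : ∀ (W : WeierstrassCurve ℚ) [W.IsElliptic] [W.IsGloballyMinimal] (N : ℕ) [NeZero N] (K : Type) [Field K] [NumberField K] (Dt : Literature.NumberTheory.EllipticCurves.ModularForms.ModularParametrizationData W N), Summit.BirchSwinnertonDyer.Rank1Residual.Additive.ClassO6 W 3 → Literature.NumberTheory.EllipticCurves.Rank1Residual.Red W 3 → (∃ Φ : AddSubgroup (WeierstrassCurve.geomTorsion W ((3 : ℕ) : ℤ)), Literature.NumberTheory.EllipticCurves.Rank1Residual.IsRationalLine W 3 Φ ∧ ∀ (v : IsDedekindDomain.HeightOneSpectrum (NumberField.RingOfIntegers ℚ)), ((3 : ℕ) : NumberField.RingOfIntegers ℚ) ∈ v.asIdeal → ∀ 𝔓 ∈ v.primesAbove,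 ¬ (∀ g ∈ 𝔓.decompositionSubgroup (Field.absoluteGaloisGroup ℚ), ∀ P ∈ Φ, g • P = P) ∧ ¬ (∀ g ∈ 𝔓.decompositionSubgroup (Field.absoluteGaloisGroup ℚ), ∀ P : WeierstrassCurve.geomTorsion W ((3 : ℕ) : ℤ), g • P - P ∈ Φ)) → W.analyticRank = 1 → W.conductorNorm ℤ = N → Literature.NumberTheory.EllipticCurves.IsImaginaryQuadratic K → Literature.NumberTheory.EllipticCurves.SatisfiesHeegnerHypothesis N K → ∀ (κ : Literature.NumberTheory.EllipticCurves.ZpExtension K 3), κ.IsAnticyclotomic → ∀ (γ : Field.absoluteGaloisGroup K) [Fact (κ.IsTopGenerator γ)] (𝔭 : IsDedekindDomain.HeightOneSpectrum (NumberField.RingOfIntegers K)), ((3 : ℕ) : NumberField.RingOfIntegers K) ∈ 𝔭.asIdeal → 𝔭.asIdeal.ramificationIdx (NumberField.RingOfIntegers ℚ) = 1 → 𝔭.asIdeal.inertiaDeg (NumberField.RingOfIntegers ℚ) = 1 → ∀ (𝔭' : IsDedekindDomain.HeightOneSpectrum (NumberField.RingOfIntegers K)), ((3 : ℕ) : NumberField.RingOfIntegers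 K) ∈ 𝔭'.asIdeal → 𝔭' ≠ 𝔭 → ∀ (ι' : PadicAlgCl 3 ≃+* ℂ), Summit.BirchSwinnertonDyer.BirchSwinnertonDyer.Theorems.SchneiderFree.BranchInducesPrime 3 ι' 𝔭 → ∀ (ΩK : ℂ) (Ωp : ℂ_[3]) (L : Literature.NumberTheory.EllipticCurves.UnrSeries 3), ΩK ≠ 0 → Ωp ≠ 0 → Literature.NumberTheory.EllipticCurves.IsBDPLFunction ι' 𝔭 κ γ Dt.f ΩK Ωp L → ∃ n : ℕ, Summit.BirchSwinnertonDyer.Rank1Residual.X11b.AcSelmer.XAc.HasCharValuationAt (W.baseChange K) 3 κ 𝔭' ∅ γ n)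
    (hIB : ∀ (W : WeierstrassCurve ℚ) [W.IsElliptic] [W.IsGloballyMinimal] (N : ℕ) [NeZero N] (K : Type) [Field K] [NumberField K] (Dt : Literature.NumberTheory.EllipticCurves.ModularForms.ModularParametrizationData W N), Summit.BirchSwinnertonDyer.Rank1Residual.Additive.ClassO6 W 3 → Literature.NumberTheory.EllipticCurves.Rank1Residual.Red W 3 → (∃ Φ : AddSubgroup (WeierstrassCurve.geomTorsion W ((3 : ℕ) : ℤ)), Literature.NumberTheory.EllipticCurves.Rank1Residual.IsRationalLine W 3 Φ ∧ ∀ (v : IsDedekindDomain.HeightOneSpectrum (NumberField.RingOfIntegers ℚ)), ((3 : ℕ) : NumberField.RingOfIntegers ℚ) ∈ v.asIdeal → ∀ 𝔓 ∈ v.primesAbove, ¬ (∀ g ∈ 𝔓.decompositionSubgroup (Field.absoluteGaloisGroup ℚ), ∀ P ∈ Φ, g • P = P) ∧ ¬ (∀ g ∈ 𝔓.decompositionSubgroup (Field.absoluteGaloisGroup ℚ), ∀ P : WeierstrassCurve.geomTorsion W ((3 : ℕ) : ℤ), g • P - P ∈ Φ)) → W.analyticRank = 1 → W.conductorNorm ℤ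 = N → Literature.NumberTheory.EllipticCurves.IsImaginaryQuadratic K → Literature.NumberTheory.EllipticCurves.SatisfiesHeegnerHypothesis N K → ∀ (κ : Literature.NumberTheory.EllipticCurves.ZpExtension K 3), κ.IsAnticyclotomic → ∀ (γ : Field.absoluteGaloisGroup K) [Fact (κ.IsTopGenerator γ)] (𝔭 : IsDedekindDomain.HeightOneSpectrum (NumberField.RingOfIntegers K)), ((3 : ℕ) : NumberField.RingOfIntegers K) ∈ 𝔭.asIdeal → 𝔭.asIdeal.ramificationIdx (NumberField.RingOfIntegers ℚ) = 1 → 𝔭.asIdeal.inertiaDeg (NumberField.RingOfIntegers ℚ) = 1 → ∀ (𝔭' : IsDedekindDomain.HeightOneSpectrum (NumberField.RingOfIntegers K)), ((3 : ℕ) : NumberField.RingOfIntegers K) ∈ 𝔭'.asIdeal → 𝔭' ≠ 𝔭 → ∀ (ι' : PadicAlgCl 3 ≃+* ℂ), Summit.BirchSwinnertonDyer.BirchSwinnertonDyer.Theorems.SchneiderFree.BranchInducesPrime 3 ι' 𝔭 → ∀ (ΩK : ℂ) (Ωp : ℂ_[3]) (L : Literature.NumberTheory.EllipticCurves.UnrSeries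 3), ΩK ≠ 0 → Ωp ≠ 0 → Literature.NumberTheory.EllipticCurves.IsBDPLFunction ι' 𝔭 κ γ Dt.f ΩK Ωp L → ∃ (C ν : ℕ) (a : IwasawaAlgebra 3), a ≠ 0 ∧ ∀ Q : ℤ_[3][X], Q.IsDistinguishedAt (IsLocalRing.maximalIdeal ℤ_[3]) → Irreducible Q → IsRelPrime a (Q : IwasawaAlgebra 3) → ∀ y : PadicAlgCl 3, Polynomial.aeval y (Q.map (algebraMap ℤ_[3] ℚ_[3])) = 0 → ∀ v : ℂ_[3], L.HasValueAt (y : ℂ_[3]) v → (Nat.card (Summit.BirchSwinnertonDyer.Rank1Residual.X11b.AcSelmer.XAc (W.baseChange K) 3 κ 𝔭' ∅ γ ⧸ (Ideal.span {(Q : IwasawaAlgebra 3)} • ⊤ : Submodule (IwasawaAlgebra 3) (Summit.BirchSwinnertonDyer.Rank1Residual.X11b.AcSelmer.XAc (W.baseChange K) 3 κ 𝔭' ∅ γ))) : ℝ) * (‖(y : ℂ_[3])‖ ^ ν * ‖v‖) ^ Q.natDegree ≤ (3 : ℝ) ^ (C * Q.natDegree)) :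
    Summit.BirchSwinnertonDyer.BirchSwinnertonDyer.Theses.CumulativeHeegnerLeopoldt.CumulativeHeegnerInclusionAtThree :=
  Summit.BirchSwinnertonDyer.BirchSwinnertonDyer.Theorems.cumulativeHeegnerLeopoldt_cumulativeHeegnerInclusionAtThreeGlue_proof
    (temperedHeegnerInclusionAtThree_of_hasCharValuationAt_of_weightedIndexBound hCTL hIB) hP
    Summit.BirchSwinnertonDyer.BirchSwinnertonDyer.Theorems.cumulativeHeegnerLeopoldt_residualSelmerFiniteAtThreeOfPrint_proof

end Summit.BirchSwinnertonDyer.BirchSwinnertonDyer.Theorems.CumulativeHeegnerInclusionAtThreeOfWeightedIndexBound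

end
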